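import Mathlib
import HarnessLib
import Summits.Ventures.LatticeQCDFlow.Exactness.SU2HeatBathLaw

/-!
# The SU(2) heat-bath recipe is exact: assembling `a₀ + √(1−a₀²) n̂·Z⃗` from A3's `a₀`-law and a uniform axis gives the link law

HONEST FRAMING: exact (Metropolis-corrected) sampling algorithms for lattice gauge theory;
figures of merit are autocorrelation/cost numbers at stated couplings and volumes; no
continuum-physics claim.

Venture `LatticeQCDFlow` (cell pub-lqcd), topic `Exactness`, FANOUT row 9 (eng-latcore, the
engine `latflow.core`).  NEW WORK of the cell, the converse ("sampling") reading of
`SU2HeatBathLaw.lean`: there the pair (`a₀`, axis) of the link law was shown to have the product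
law `A3 ⊗ uniformSphere`; here the ASSEMBLY map `(a₀, n̂) ↦ a₀ + √(1−a₀²) n̂·Z⃗` (the last line
of the Creutz / Kennedy–Pendleton heat bath, `latflow.core` `ckernels`/`sun.py` SU(2) kernel) is
shown to push that product law forward to the link law itself.  Over row 9's
`HaarSU2Gaussian.lean` (Haar = normalised Gaussian quaternion) and Mathlib.  Nothing is cited as a
fact.  Printed counterparts, NAMED ONLY: Creutz 1980 §III; Kennedy–Pendleton 1985;
Gattringer–Lang 2010 eq. (4.36)–(4.38).

## What is proved (`σ = uniformSphere volume` on `S² ⊂ E3`, `pair U = (su2a0 U, su2axis U)`)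

* `unsplitR4 (t, v)` — reassemble `ℝ × ℝ³ → ℝ⁴`; `assembleSU2 (t, n) = gaussUnit (unsplitR4 (t, √(1−t²)•n))`
  — the heat-bath assembly map, measurable; `coe_assembleSU2`: for `t² ≤ 1` its matrix IS
  `quatVec (t, √(1−t²) n)` = `t·1 + √(1−t²)(n₁Z₁ + n₂Z₂ + n₃Z₃)` (no normalisation happens).
* `gaussUnit_smul` — the unit quaternion of `x` is invariant under positive rescaling;
  **`assembleSU2_pair_gaussUnit`** — `assembleSU2 (pair (gaussUnit x)) = gaussUnit x` for EVERY
  `x ≠ 0` (also on the axis-degenerate line `tail x = 0`, where `√(1−a₀²) = 0` kills the junk axis).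
* `map_withDensity_comp` — `(W∘f · μ).map f = W · (μ.map f)` (bookkeeping).
* **`map_assembleSU2_pair_linkLaw`** — `assembleSU2 ∘ pair` fixes every link law
  `e^{c a₀} dHaar` (it is the identity off a null set);
  **`map_assembleSU2_linkLaw`** — `((2/π)√(1−t²)e^{ct} dt ⊗ σ).map assembleSU2 = e^{c a₀(U)} dHaar(U)`:
  drawing `a₀` from A3's density and the axis uniformly on `S²`, independently, and assembling,
  produces EXACTLY the (unnormalised) SU(2) one-link heat-bath target; `map_assembleSU2_haar` — the
  `c = 0` case: `(semicircleLaw ⊗ σ).map assembleSU2 = Haar`.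

NOT CLAIMED: the staple rotation `U ↦ U ŝ†` (a Haar-preserving right translation, typed elsewhere:
`SubgroupHeatBath` / `CompactHaar`); floating point; how `a₀` and the axis are DRAWN (rejection
loop `RejectionSampling.lean`; the axis draw is Muller's method `StdGaussianRadial.lean` or the
engine's `(cos θ, φ)` chart — the latter untyped).
-/

namespace Summit.Ventures.LatticeQCDFlow.Exactness

open MeasureTheory Measure Metric Set ProbabilityTheory WithLp Matrix
open scoped ENNReal

/-! ## §1 Reassembling `ℝ⁴` and the assembly map -/

section Assemble

/-- Reassemble `x ∈ ℝ⁴` from `(x₀, tail x)`. -/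
noncomputable def unsplitR4 (p : ℝ × E3) : R4 := toLp 2 (Fin.cons p.1 (fun j : Fin 3 => p.2 j))

/-- Coordinate `0` of the reassembled vector. -/
@[simp] theorem unsplitR4_apply_zero (p : ℝ × E3) : unsplitR4 p 0 = p.1 := rfl

/-- Coordinates `j+1` of the reassembled vector. -/
@[simp] theorem unsplitR4_apply_succ (p : ℝ × E3) (j : Fin 3) : unsplitR4 p j.succ = p.2 j := by
  simp [unsplitR4]

/-- `unsplitR4 ∘ splitR4 = id`. -/
theorem unsplitR4_splitR4 (x : R4) : unsplitR4 (splitR4 x) = x := by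
  ext i
  refine Fin.cases ?_ (fun j => ?_) i
  · rfl
  · rw [unsplitR4_apply_succ]; rfl

/-- The tail of the reassembled vector. -/
@[simp] theorem tailR4_unsplitR4 (p : ℝ × E3) : tailR4 (unsplitR4 p) = p.2 := by
  ext j; simp [tailR4]

/-- `‖unsplitR4 (t, v)‖² = t² + ‖v‖²`. -/
theorem norm_sq_unsplitR4 (p : ℝ × E3) : ‖unsplitR4 p‖ ^ 2 = p.1 ^ 2 + ‖p.2‖ ^ 2 := by
  rw [norm_sq_eq_add_tail, unsplitR4_apply_zero, tailR4_unsplitR4]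

/-- Reassembly commutes with scaling. -/
theorem unsplitR4_smul (c : ℝ) (p : ℝ × E3) : unsplitR4 (c * p.1, c • p.2) = c • unsplitR4 p := by
  ext i
  refine Fin.cases ?_ (fun j => ?_) i
  · simp
  · rw [unsplitR4_apply_succ]; simp

/-- `unsplitR4` is measurable. -/
theorem measurable_unsplitR4 : Measurable unsplitR4 := by
  refine (measurable_toLp 2 _).comp (measurable_pi_iff.2 fun i => ?_)
  refine Fin.cases ?_ (fun j => ?_) i
  · simpa using measurable_fst
  · simp only [Fin.cons_succ]
    exact (measurable_pi_apply j).comp ((measurable_ofLp 2 _).comp measurable_snd)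

/-- **The heat-bath assembly map** `(a₀, n̂) ↦ a₀ + √(1−a₀²) n̂·Z⃗ ∈ SU(2)` (as the unit quaternion of
the vector `(a₀, √(1−a₀²) n̂)`, which already has norm one when `a₀² ≤ 1`). -/
noncomputable def assembleSU2 (p : ℝ × sphere (0 : E3) 1) : Matrix.specialUnitaryGroup (Fin 2) ℂ :=
  gaussUnit (unsplitR4 (p.1, Real.sqrt (1 - p.1 ^ 2) • (p.2 : E3)))

/-- `assembleSU2` is measurable. -/
theorem measurable_assembleSU2 : Measurable assembleSU2 :=
  measurable_gaussUnit.comp (measurable_unsplitR4.comp (measurable_fst.prodMk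
    (((measurable_const.sub (measurable_fst.pow_const 2)).sqrt).smul
      (measurable_subtype_coe.comp measurable_snd))))

/-- For `a₀² ≤ 1` the assembled vector has norm one … -/
theorem norm_unsplitR4_assemble {t : ℝ} (ht : t ^ 2 ≤ 1) (n : sphere (0 : E3) 1) :
    ‖unsplitR4 (t, Real.sqrt (1 - t ^ 2) • (n : E3))‖ = 1 := by
  have h : ‖unsplitR4 (t, Real.sqrt (1 - t ^ 2) • (n : E3))‖ ^ 2 = 1 := by
    rw [norm_sq_unsplitR4, norm_smul, Real.norm_of_nonneg (Real.sqrt_nonneg _), norm_eq_of_mem_sphere n,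
      mul_one, Real.sq_sqrt (sub_nonneg.2 ht)]
    ring
  have h' := (pow_left_inj₀ (norm_nonneg _) zero_le_one two_ne_zero).1 (h.trans (one_pow 2).symm)
  exact h'

/-- … so no normalisation happens: the matrix of `assembleSU2 (a₀, n̂)` is `quatVec (a₀, √(1−a₀²) n̂)`,
i.e. `a₀·1 + √(1−a₀²)(n₁Z₁ + n₂Z₂ + n₃Z₃)`. -/
theorem coe_assembleSU2 {t : ℝ} (ht : t ^ 2 ≤ 1) (n : sphere (0 : E3) 1) :
    (assembleSU2 (t, n) : Matrix (Fin 2) (Fin 2) ℂ) = quatVec (unsplitR4 (t, Real.sqrt (1 - t ^ 2) • (n : E3))) := by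
  have h1 := norm_unsplitR4_assemble ht n
  have hne : unsplitR4 (t, Real.sqrt (1 - t ^ 2) • (n : E3)) ≠ 0 := by
    intro h0; rw [h0, norm_zero] at h1; exact zero_ne_one h1
  rw [assembleSU2, coe_gaussUnit_of_ne_zero hne, h1, inv_one, one_smul]

end Assemble

/-! ## §2 Assembly inverts (`a₀`, axis) off a null set -/

section Inverse

/-- The unit quaternion is invariant under positive rescaling of `x`. -/
theorem gaussUnit_smul {c : ℝ} (hc : 0 < c) (x : R4) : gaussUnit (c • x) = gaussUnit x := by
  by_cases hx : x = 0
  · rw [hx, smul_zero]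
  · have hcx : c • x ≠ 0 := smul_ne_zero hc.ne' hx
    apply Subtype.ext
    have hn : ‖x‖ ≠ 0 := norm_ne_zero_iff.2 hx
    have hc0 : c ≠ 0 := hc.ne'
    rw [coe_gaussUnit_of_ne_zero hcx, coe_gaussUnit_of_ne_zero hx, norm_smul, Real.norm_of_nonneg hc.le,
      smul_smul]
    congr 2
    field_simp

/-- **Assembly inverts (`a₀`, axis) on the Gaussian quaternion**: for every `x ≠ 0`,
`assembleSU2 (a₀ (gaussUnit x), axis (gaussUnit x)) = gaussUnit x` — including the axis-degenerate
line `tail x = 0`, where `√(1−a₀²) = 0`. -/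
theorem assembleSU2_pair_gaussUnit {x : R4} (hx : x ≠ 0) :
    assembleSU2 (su2a0 (gaussUnit x), su2axis (gaussUnit x)) = gaussUnit x := by
  have hn : 0 < ‖x‖ := norm_pos_iff.2 hx
  have hn0 : ‖x‖ ≠ 0 := hn.ne'
  rw [assembleSU2, su2a0_gaussUnit hx, su2axis_gaussUnit hx]
  -- `√(1 − a₀²) = ‖tail x‖/‖x‖`
  have hsq : Real.sqrt (1 - (‖x‖⁻¹ * x 0) ^ 2) = ‖x‖⁻¹ * ‖tailR4 x‖ := by
    have h1 : 1 - (‖x‖⁻¹ * x 0) ^ 2 = (‖x‖⁻¹ * ‖tailR4 x‖) ^ 2 := by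
      have := norm_sq_eq_add_tail x
      field_simp
      linarith
    rw [h1, Real.sqrt_sq (mul_nonneg (inv_nonneg.2 hn.le) (norm_nonneg _))]
  -- `√(1 − a₀²) • axis = tail x/‖x‖`, whether or not the tail vanishes
  have hvec : Real.sqrt (1 - (‖x‖⁻¹ * x 0) ^ 2) • (dirSphere (tailR4 x) : E3) = ‖x‖⁻¹ • tailR4 x := by
    rw [hsq]
    by_cases ht : tailR4 x = 0
    · rw [ht, norm_zero, mul_zero, zero_smul, smul_zero]
    · rw [dirSphere_coe ht, smul_smul, mul_assoc, mul_inv_cancel₀ (norm_ne_zero_iff.2 ht), mul_one]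
  rw [hvec, show ((‖x‖⁻¹ * x 0, ‖x‖⁻¹ • tailR4 x) : ℝ × E3) =
      (‖x‖⁻¹ * (splitR4 x).1, ‖x‖⁻¹ • (splitR4 x).2) from rfl, unsplitR4_smul, unsplitR4_splitR4,
    gaussUnit_smul (inv_pos.2 hn)]

end Inverse

/-! ## §3 The recipe's output law is the link law -/

section Law

/-- Pushing a weight that factors through the map: `(W∘f · μ).map f = W · (μ.map f)`. -/
theorem map_withDensity_comp {α β : Type*} [MeasurableSpace α] [MeasurableSpace β] (μ : Measure α)
    {f : α → β} (hf : Measurable f) {W : β → ℝ≥0∞} (hW : Measurable W) :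
    (μ.withDensity fun a => W (f a)).map f = (μ.map f).withDensity W := by
  ext s hs
  rw [Measure.map_apply hf hs, withDensity_apply _ (hf hs), withDensity_apply _ hs, setLIntegral_map hs hW hf]

/-- **`assembleSU2 ∘ (a₀, axis)` fixes every link law** `e^{c a₀(U)} dHaar(U)`. -/
theorem map_assembleSU2_pair_linkLaw (c : ℝ) :
    ((Literature.MathematicalPhysics.QuantumFieldTheory.haarProbability (Matrix.specialUnitaryGroup (Fin 2) ℂ)).withDensity (fun U => ENNReal.ofReal (Real.exp (c * su2a0 U)))).map
        (fun U => assembleSU2 (su2a0 U, su2axis U)) =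
      (Literature.MathematicalPhysics.QuantumFieldTheory.haarProbability (Matrix.specialUnitaryGroup (Fin 2) ℂ)).withDensity (fun U => ENNReal.ofReal (Real.exp (c * su2a0 U))) := by
  set W : Matrix.specialUnitaryGroup (Fin 2) ℂ → ℝ≥0∞ := fun U => ENNReal.ofReal (Real.exp (c * su2a0 U)) with hWdef
  have hW : Measurable W :=
    (Real.measurable_exp.comp (measurable_const.mul continuous_su2a0.measurable)).ennreal_ofReal
  have hAP : Measurable fun U : Matrix.specialUnitaryGroup (Fin 2) ℂ => assembleSU2 (su2a0 U, su2axis U) :=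
    measurable_assembleSU2.comp measurable_a0_axis
  -- move to the Gaussian quaternion
  rw [← map_gaussUnit_stdGaussian, ← map_withDensity_comp _ measurable_gaussUnit hW,
    Measure.map_map hAP measurable_gaussUnit]
  have hae : (fun U : Matrix.specialUnitaryGroup (Fin 2) ℂ => assembleSU2 (su2a0 U, su2axis U)) ∘ gaussUnit
      =ᵐ[(stdGaussian R4).withDensity fun x => W (gaussUnit x)] gaussUnit := by
    have h0 : ((stdGaussian R4).withDensity fun x => W (gaussUnit x)) {(0 : R4)} = 0 :=
      withDensity_absolutelyContinuous _ _ stdGaussian_singleton_zero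
    filter_upwards [compl_mem_ae_iff.2 h0] with x hx
    exact assembleSU2_pair_gaussUnit hx
  rw [Measure.map_congr hae]

/-- **The SU(2) heat-bath recipe is exact.**  Drawing `a₀` from `(2/π)√(1−t²)e^{ct} dt` (A3's
reference density, unnormalised), the axis `n̂` uniformly on `S²`, independently, and assembling
`a₀ + √(1−a₀²) n̂·Z⃗` produces EXACTLY the one-link law `e^{c a₀(U)} dHaar(U)`. -/
theorem map_assembleSU2_linkLaw (c : ℝ) :
    ((volume.withDensity (fun t => ENNReal.ofReal (semicircleDensity t * Real.exp (c * t)))).prod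
        (uniformSphere (volume : Measure E3))).map assembleSU2 =
      (Literature.MathematicalPhysics.QuantumFieldTheory.haarProbability (Matrix.specialUnitaryGroup (Fin 2) ℂ)).withDensity (fun U => ENNReal.ofReal (Real.exp (c * su2a0 U))) := by
  rw [← map_a0_axis_linkLaw c, Measure.map_map measurable_assembleSU2 measurable_a0_axis]
  exact map_assembleSU2_pair_linkLaw c

/-- The `c = 0` case: **assembling a semicircle-distributed `a₀` and an independent uniform axis
samples the Haar probability of SU(2)**. -/
theorem map_assembleSU2_haar :
    (semicircleLaw.prod (uniformSphere (volume : Measure E3))).map assembleSU2 = (Literature.MathematicalPhysics.QuantumFieldTheory.haarProbability (Matrix.specialUnitaryGroup (Fin 2) ℂ)) := by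
  have h := map_assembleSU2_linkLaw 0
  simp only [zero_mul, Real.exp_zero, mul_one, ENNReal.ofReal_one] at h
  rw [show (fun _ : Matrix.specialUnitaryGroup (Fin 2) ℂ => (1 : ℝ≥0∞)) = 1 from rfl, withDensity_one] at h
  rw [semicircleLaw]
  exact h

end Law

end Summit.Ventures.LatticeQCDFlow.Exactness
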